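import Literature.IUT.HodgeTheaters.Labels
import Literature.IUT.HodgeTheaters.PMBaseStrips
import Literature.IUT.HodgeTheaters.ThetaHodgeTheatersRemarksB

/-!
# Kernel DAG index — layer L5, part c (MACHINE DELTA-DRAFT by abc-iut-dag `tools/mkkernel.py` @2026-08-25T20:07Z: 3 landed nodes NOT YET in the tree index Summits/ABC/IUTFork/DAG*.lean filed by abc-iut-c312-2; spec v1.3)

THIS FILE PROVES NOTHING NEW AND ASSERTS NOTHING (plan/KERNEL-DAG-SPEC.md). It gives ONE NAME `N_<kernel_id>` to each DAG node whose
statement has LANDED through the gate, knitting the landed declarations BY NAME. Witness naming (c312-2 F1/F2, 18:39:37Z): `N_<id>_holds`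
exists iff the DAG row is `discharged(p)` (it IS the kernel-checked theorems); a landed row not yet marked discharged by its lead gets the same
conjunction witnessed as `N_<id>_part`; FACT-style `def … : Prop` claims get a name and no witness; CLAIM-FORM items ([IUTchIII] Cor 3.12,
[IUTchIV] Thm 1.10) are `abbrev N_<id> (X) : Prop := X.<Claim>` and the theorems that assume them are EDGES `E_<dst>_of_<src>` (no `__`). Nothing here says abc is proved or refuted or takes a side on [IUTchIII] Cor 3.12. typed ≠ discharged; indexed ≠ endorsed.
Filer of the tree copy: abc-iut-c312-2 (`Summits/ABC/IUTFork/DAGL5c.lean`); this draft is regenerated hourly and is not the tree.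
FILED COPY (filed by abc-iut-c312-8 for the index owner abc-iut-c312-2, WAVE2-SLICES row 78; post-processed by c312-2's fixdraft.py): claim nodes are claim-form abbrevs without `_holds`;
`_holds` only for DAG rows marked discharged, `_part` otherwise (spec §2(b),(c)); edges by name (§3).
-/

namespace Summit.ABC.IUTFork.DAG

namespace PartL5c
/-- `StatementOf h` is the statement (a `Prop`) of which the landed `h` is the proof: the index NAMES statements, it never re-types them. -/
abbrev StatementOf {P : Prop} (_h : P) : Prop := P
end PartL5c
open PartL5c

noncomputable section
universe u₁ u₂ u₃ u₄ u₅ u₆ u₇ u₈ u₉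

/-- [node IUTchI:Def3.1 · L5/D2 · [IUTchI] Def 3.1, kurims p.61 · p403780 · claim · DAG status discharged(p405296)] decls 1 · cites→ IUTchI:Def1.1,IUTchI:Rmk1.1.2,IUTchI:Rmk3.1.1 -/
abbrev N_IUTchI_Def3_1 : Prop := StatementOf @Literature.IUT.HodgeTheaters.two_le_lStar
/-- discharge of `N_IUTchI_Def3_1`: the landed theorems it names, BY NAME (spec §2(c)); proves nothing new. -/
theorem N_IUTchI_Def3_1_holds : N_IUTchI_Def3_1 := @Literature.IUT.HodgeTheaters.two_le_lStar

/-- [node IUTchI:Rmk3.5.2(i) · L5/D2 · [IUTchI] Rmk 3.5.2 (i), kurims p.87 · p405989 · data] decls 1 · cites→ IUTchI:Ex3.5 -/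
abbrev N_IUTchI_Rmk3_5_2_i := @Literature.IUT.HodgeTheaters.Capsule.constituent.{u₁, u₂, u₃}

/-- [node IUTchI:Def6.1(iii) · L5/D2 · [IUTchI] Def 6.1 (iii), kurims p.155 · p405878 · claim · DAG status discharged(p405878)] decls 2 · cites→ IUTchI:Cor1.2,IUTchI:Def3.1,IUTchI:Def4.1,IUTchI:Ex4.3,IUTchI:Prop4.2,IUTchI:Rmk1.2.2,IUTchI:Rmk3.1.2,IUTchI:Rmk6.1.1 -/
abbrev N_IUTchI_Def6_1_iii : Prop := StatementOf @Literature.IUT.HodgeTheaters.FlPMTorsor.mem_autPlus_iff.{u₁}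
/-- discharge of `N_IUTchI_Def6_1_iii`: the landed theorems it names, BY NAME (spec §2(c)); proves nothing new. -/
theorem N_IUTchI_Def6_1_iii_holds : N_IUTchI_Def6_1_iii := @Literature.IUT.HodgeTheaters.FlPMTorsor.mem_autPlus_iff
example := @Literature.IUT.HodgeTheaters.FlPMTorsor.autPlus.{u₁}

end

end Summit.ABC.IUTFork.DAG
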